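import Summits.BirchSwinnertonDyer.BirchSwinnertonDyer.Theorems.Rank2Observatory718b1TwoDescRankTwo
import Summits.BirchSwinnertonDyer.BirchSwinnertonDyer.Theorems.ShaPrimaryTransferFiniteShaComponentTransferSelmerCubicDoor
import Literature.NumberTheory.EllipticCurves.KubertTateSevenRational
import HarnessLib

/-!
# BirchSwinnertonDyer — `t₂(718b1) = 0`, `Ш(718b1/ℚ)[2^∞] = 0`, `rank = 2` by the `2`-SELMER upgrade of the kernel general
# `2`-descent (SEL2CUBIC door, totally real cubic `2`-division field)

HONEST FRAMING: a per-curve certified theorem; no claim on BSD in rank ≥ 2. Route `ShaPrimaryTransfer`, seat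
`bsd-line-spt-p1`; item T = `FiniteShaComponentTransfer` (stmt-22356) UNCHANGED (conjecture-grade at corank ≥ 2).
THEOREMS ONLY; generated from the cell-`b2b-bsdr2` certificate `Rank2Observatory718b1TwoDescRankTwo` (model
`(⟨0, 1, 0, -72, 16⟩ : WeierstrassCurve ℚ)`, field `CubicField (-9) 16 (-6)`, three-real-place sieve `admStd3R`, residue moduli `[4]`) by
`shaCorank_two_eq_zero_of_admStd3RQ` (`…SelmerCubicDoor`): the certificate's own side data
(norms, sign bits, generator primes, support of `F′(θ)`, units modulo squares, kernel count of admissible pairs `≤ 4`)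
and its rank lower bound give, for ALL of `Sel⁽²⁾(E/ℚ)` instead of `E(ℚ)/2E(ℚ)`:

* **`sha_door`** — `t₂(E) = 0 ∧ Ш(E/ℚ)[2^∞] = 0 ∧ rank E(ℚ) = 2` for the model `(⟨0, 1, 0, -72, 16⟩ : WeierstrassCurve ℚ)`;
* `shaCorank_two_eq_zero`, `primaryComponent_sha_two_eq_bot`; `shaCorank_two_eq_zero_cremona` for Cremona's model
  `⟨1, 0, 1, -5, 0⟩` (variable change `variableChange_smul`).

UNCONDITIONAL (complete `2`-descent; no `L`-function, no Gross–Zagier–Kolyvagin). BSD is NOT proved by this.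
[cite: Cassels1991LecturesEllipticCurves, §15] [cite: CremonaAlgorithms1997, §3.6 and §3.5 (Cremona label `718b1`)]
[cite: SilvermanAEC2009, Thm. X.4.2]
-/

-- single-conjunct summit: `Summit.BirchSwinnertonDyer.BirchSwinnertonDyer.…` repeats the name by design
set_option linter.dupNamespace false

noncomputable section

open scoped Classical NumberField

open Literature.NumberTheory.NumberFields Literature.NumberTheory.EllipticCurves
  Literature.NumberTheory.GaloisRepresentations Polynomial Module NumberField IsDedekindDomain
open WeierstrassCurve WeierstrassCurve.Affine

namespace Summit.BirchSwinnertonDyer.BirchSwinnertonDyer.Theorems.ShaPrimaryTransferSelmerCubic718b1Sha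

open Summit.BirchSwinnertonDyer.BirchSwinnertonDyer.Rank2Observatory
open Summit.BirchSwinnertonDyer.BirchSwinnertonDyer.Rank2Observatory.TwoDescCubic
open Summit.BirchSwinnertonDyer.BirchSwinnertonDyer.Rank2Observatory.TwoDescCubic.FieldR1436
open Summit.BirchSwinnertonDyer.BirchSwinnertonDyer.Rank2Observatory.C718b1
open Summit.BirchSwinnertonDyer.BirchSwinnertonDyer.Theorems.ShaPrimaryTransferSelmerCubicCover

/-- `E_K` is elliptic over the cubic `2`-division field. [cite: CremonaAlgorithms1997, §3.5 (Cremona label `718b1`)] -/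
theorem isElliptic_baseChange : ((⟨0, 1, 0, -72, 16⟩ : WeierstrassCurve ℚ).baseChange (CubicField (-9) 16 (-6))).IsElliptic :=
  haveI := isElliptic
  (⟨0, 1, 0, -72, 16⟩ : WeierstrassCurve ℚ).isElliptic_baseChange (CubicField (-9) 16 (-6))

/-- Cremona's model `⟨1, 0, 1, -5, 0⟩` of `718b1` and the certificate's model `(⟨0, 1, 0, -72, 16⟩ : WeierstrassCurve ℚ)` differ by an admissible change of
variables over `ℚ` (completing the square: `u = 1/2`, `r = 0`, `s = −a₁/2`, `t = −a₃/2`).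
[cite: CremonaAlgorithms1997, §3.5 (Cremona label `718b1`)] -/
theorem variableChange_smul :
    (⟨Units.mk0 (1 / 2 : ℚ) (by norm_num), 0, -(1 : ℚ) / 2, -(1 : ℚ) / 2⟩ : WeierstrassCurve.VariableChange ℚ) •
      ((⟨1, 0, 1, -5, 0⟩ : WeierstrassCurve ℤ).map (Int.castRingHom ℚ)) = (⟨0, 1, 0, -72, 16⟩ : WeierstrassCurve ℚ) := by
    ext <;> simp only [WeierstrassCurve.map_a₁, WeierstrassCurve.map_a₂, WeierstrassCurve.map_a₃,
      WeierstrassCurve.map_a₄, WeierstrassCurve.map_a₆, WeierstrassCurve.variableChange_a₁,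
      WeierstrassCurve.variableChange_a₂, WeierstrassCurve.variableChange_a₃,
      WeierstrassCurve.variableChange_a₄, WeierstrassCurve.variableChange_a₆, Units.val_inv_eq_inv_val,
      Units.val_mk0] <;> norm_num

/-- **The SEL2CUBIC door for `718b1`**: `t₂(E) = corank_{ℤ₂} Ш(E/ℚ)[2^∞] = 0`, `Ш(E/ℚ)[2^∞] = 0` and
`rank E(ℚ) = 2` for the model `(⟨0, 1, 0, -72, 16⟩ : WeierstrassCurve ℚ)` — UNCONDITIONAL (`#Sel⁽²⁾(E/ℚ) ≤ 4` by the Selmer cover of the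
certificate's sieve, `rank ≥ 2` from the certificate). [cite: Cassels1991LecturesEllipticCurves, §15]
[cite: SilvermanAEC2009, Thm. X.4.2, Rem. X.4.1] -/
theorem sha_door :
    (⟨0, 1, 0, -72, 16⟩ : WeierstrassCurve ℚ).shaCorank 2 = 0 ∧ AddCommGroup.primaryComponent (⟨0, 1, 0, -72, 16⟩ : WeierstrassCurve ℚ).sha 2 = ⊥ ∧
      (⟨0, 1, 0, -72, 16⟩ : WeierstrassCurve ℚ).mordellWeilRank = 2 := by
  haveI := isElliptic
  haveI := isElliptic_baseChange
  obtain ⟨σ₁, hσ₁lo, hσ₁hi⟩ := FieldR1436.exists_rho1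
  obtain ⟨σ₂, hσ₂lo, hσ₂hi⟩ := FieldR1436.exists_rho2
  obtain ⟨σ₃, hσ₃lo, hσ₃hi⟩ := FieldR1436.exists_rho3
  have hGi : Function.Injective (![lin aeval_α (-2) 1 0, lin aeval_α (-1) 7 (-3)] : Fin 2 → 𝓞 (CubicField (-9) 16 (-6))) := by
    intro i j h
    fin_cases i <;> fin_cases j
    · rfl
    · exact absurd h (lin_ne irreducible aeval_α finrank_eq (c₀ := (-2)) (c₁ := 1) (c₂ := 0)
        (d₀ := (-1)) (d₁ := 7) (d₂ := (-3)) (by decide))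
    · exact absurd h (lin_ne irreducible aeval_α finrank_eq (c₀ := (-1)) (c₁ := 7) (c₂ := (-3))
        (d₀ := (-2)) (d₁ := 1) (d₂ := 0) (by decide))
    · rfl
  have hGp : ∀ j, Prime ((![lin aeval_α (-2) 1 0, lin aeval_α (-1) 7 (-3)] : Fin 2 → 𝓞 (CubicField (-9) 16 (-6))) j) := by
    intro j
    fin_cases j
    · exact TwoDescCubic.FieldR1436.e_m2_1_0_prime
    · exact TwoDescCubic.FieldR1436.e_m1_7_m3_prime
  have h12 : σ₁ (algebraMap (𝓞 (CubicField (-9) 16 (-6))) (CubicField (-9) 16 (-6)) (lin aeval_α (-14) 10 (-1))) < σ₂ (algebraMap (𝓞 (CubicField (-9) 16 (-6))) (CubicField (-9) 16 (-6)) (lin aeval_α (-14) 10 (-1))) :=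
    lin_lt_lin aeval_α σ₁ σ₂ (by norm_num) hσ₁lo hσ₁hi (by norm_num) hσ₂lo hσ₂hi (-14) 10 (-1)
      (by norm_num)
  have h23 : σ₂ (algebraMap (𝓞 (CubicField (-9) 16 (-6))) (CubicField (-9) 16 (-6)) (lin aeval_α (-14) 10 (-1))) < σ₃ (algebraMap (𝓞 (CubicField (-9) 16 (-6))) (CubicField (-9) 16 (-6)) (lin aeval_α (-14) 10 (-1))) :=
    lin_lt_lin aeval_α σ₂ σ₃ (by norm_num) hσ₂lo hσ₂hi (by norm_num) hσ₃lo hσ₃hi (-14) 10 (-1)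
      (by norm_num)
  have hrank : 2 ≤ (⟨0, 1, 0, -72, 16⟩ : WeierstrassCurve ℚ).mordellWeilRank := by
    rw [← mordellWeilRank_eq_of_smul_eq _ _ _ variableChange_smul, C718b1.mordellWeilRank_eq_two]
  refine shaCorank_two_eq_zero_of_admStd3RQ (A := 1) (B := (-72)) (C := 16) (⟨0, 1, 0, -72, 16⟩ : WeierstrassCurve ℚ) rfl (by norm_num) rfl
    (by norm_num) (by norm_num) irreducible_F aeval_theta finrank_eq σ₁ σ₂ σ₃ h12 h23 hGi hGp support_deriv units_span
    (Nu := (![-1, -1, 1] : Fin 3 → ℤ)) (Ng := (![2, -359] : Fin 2 → ℤ)) (su₁ := (![true, true, false] : Fin 3 → Bool)) (su₂ := (![true, true, true] : Fin 3 → Bool)) (su₃ := (![true, true, true] : Fin 3 → Bool)) (sg₁ := (![true, false] : Fin 2 → Bool)) (sg₂ := (![true, false] : Fin 2 → Bool)) (sg₃ := (![false, true] : Fin 2 → Bool))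
    ?_ ?_ ?_ ?_ ?_ ?_ ?_ ?_ [4] (by decide) (r := 2) (by decide +kernel) hrank
  · intro i
    exact units_norm i
  · intro j
    fin_cases j
    · exact TwoDescCubic.FieldR1436.e_m2_1_0_norm
    · exact TwoDescCubic.FieldR1436.e_m1_7_m3_norm
  · intro i
    have h := units_sign1 σ₁ hσ₁lo hσ₁hi i
    fin_cases i <;> simpa using h
  · intro i
    have h := units_sign2 σ₂ hσ₂lo hσ₂hi i
    fin_cases i <;> simpa using h
  · intro i
    have h := units_sign3 σ₃ hσ₃lo hσ₃hi i
    fin_cases i <;> simpa using h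
  · intro j
    fin_cases j
    · simpa using lin_neg aeval_α σ₁ (by norm_num) hσ₁lo hσ₁hi (-2) 1 0 (by norm_num)
    · simpa using (lin_pos aeval_α σ₁ (by norm_num) hσ₁lo hσ₁hi (-1) 7 (-3) (by norm_num)).le
  · intro j
    fin_cases j
    · simpa using lin_neg aeval_α σ₂ (by norm_num) hσ₂lo hσ₂hi (-2) 1 0 (by norm_num)
    · simpa using (lin_pos aeval_α σ₂ (by norm_num) hσ₂lo hσ₂hi (-1) 7 (-3) (by norm_num)).le
  · intro j
    fin_cases j
    · simpa using (lin_pos aeval_α σ₃ (by norm_num) hσ₃lo hσ₃hi (-2) 1 0 (by norm_num)).le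
    · simpa using lin_neg aeval_α σ₃ (by norm_num) hσ₃lo hσ₃hi (-1) 7 (-3) (by norm_num)

/-- **`t₂(718b1) = 0`** (model `(⟨0, 1, 0, -72, 16⟩ : WeierstrassCurve ℚ)`), UNCONDITIONAL. [cite: SilvermanAEC2009, Thm. X.4.2] -/
theorem shaCorank_two_eq_zero : (⟨0, 1, 0, -72, 16⟩ : WeierstrassCurve ℚ).shaCorank 2 = 0 := sha_door.1

/-- **`Ш(718b1/ℚ)[2^∞] = 0`** (model `(⟨0, 1, 0, -72, 16⟩ : WeierstrassCurve ℚ)`), UNCONDITIONAL. [cite: SilvermanAEC2009, Thm. X.4.2] -/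
theorem primaryComponent_sha_two_eq_bot : AddCommGroup.primaryComponent (⟨0, 1, 0, -72, 16⟩ : WeierstrassCurve ℚ).sha 2 = ⊥ := sha_door.2.1

/-- **`rank 718b1(ℚ) = 2` re-derived through the Selmer bound** (model `(⟨0, 1, 0, -72, 16⟩ : WeierstrassCurve ℚ)`).
[cite: CremonaAlgorithms1997, §3.5 (Cremona label `718b1`)] -/
theorem mordellWeilRank_eq_two' : (⟨0, 1, 0, -72, 16⟩ : WeierstrassCurve ℚ).mordellWeilRank = 2 := sha_door.2.2

/-- **`t₂(718b1) = 0` for Cremona's model `⟨1, 0, 1, -5, 0⟩`** (`t_p` is an isomorphism invariant,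
`shaCorank_eq_zero_iff_of_smul_eq`). UNCONDITIONAL; BSD for `718b1` is NOT claimed.
[cite: CremonaAlgorithms1997, §3.5 (Cremona label `718b1`)] [cite: SilvermanAEC2009, Thm. X.4.2] -/
theorem shaCorank_two_eq_zero_cremona : ((⟨1, 0, 1, -5, 0⟩ : WeierstrassCurve ℤ).map (Int.castRingHom ℚ)).shaCorank 2 = 0 := by
  haveI := isElliptic
  haveI : ((⟨1, 0, 1, -5, 0⟩ : WeierstrassCurve ℤ).map (Int.castRingHom ℚ)).IsElliptic := by
    rw [← inv_smul_smul (⟨Units.mk0 (1 / 2 : ℚ) (by norm_num), 0, -(1 : ℚ) / 2, -(1 : ℚ) / 2⟩ : WeierstrassCurve.VariableChange ℚ) ((⟨1, 0, 1, -5, 0⟩ : WeierstrassCurve ℤ).map (Int.castRingHom ℚ)), variableChange_smul]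
    infer_instance
  exact (shaCorank_eq_zero_iff_of_smul_eq _ _ _ variableChange_smul 2).mpr shaCorank_two_eq_zero

end Summit.BirchSwinnertonDyer.BirchSwinnertonDyer.Theorems.ShaPrimaryTransferSelmerCubic718b1Sha

end
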